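import Literature.Geometry.Lorentzian.KerrStarSlices
import Literature.Analysis.Fourier.L2FourierDeriv
import Literature.Analysis.Fourier.L2FourierCLM
import HarnessLib

/-!
# Time-`L²` classes of the angular slices on Kerr and their Fourier transform in `t*`

Dafermos–Rodnianski–Shlapentokh-Rothman, arXiv:1402.7034, §5.1 (Def. 5.1.1, "sufficiently
integrable") and §5.2.2 ("we may consider the Fourier transform `Ψ̂(ω, ·)` …
`∂_t ↦ -iω`"). For a function `G` on the coordinate space `q = (t*, r, θ, φ*)` whose angular
slices `Kerr.angSlice G t r ∈ 𝓚 = L²([-1,1] × 𝕋)` are square integrable in `t*` at each `r`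
(`Kerr.TimeSqInt`), this file packages

* `Kerr.timeLp G r ∈ 𝓗 = L²(ℝ_{t*}; 𝓚)` and `Kerr.freqLp G r = 𝓕 (timeLp G r)` (Mathlib's
  `L²` Fourier transform, `𝓕f(ξ) = ∫ e^{-2πiξt} f(t) dt`, so DRSR's `ω` is `-2πξ`);
* **regularity in `r`** (`continuous_timeLp`, `hasDerivAt_timeLp`, and the same for `freqLp`):
  under uniform-in-`r` time-integrability of the next `r`-derivatives, `r ↦ timeLp G r` is
  continuous, resp. differentiable with derivative `timeLp (∂₁G) r`;
* **the time-derivative rule** `freqLp (∂₀G) r = (2πiξ) • freqLp G r` a.e. in `ξ`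
  (`freqLp_dir0_ae_eq`) — "`∂_t ↦ -iω`";
* **multiplication by `cos²θ`**: `angSlice (cos²θ · G) = mulSqFst (angSlice G)`,
  `timeLp (cos²θ · G) = mulSqFst ∘ timeLp G` and hence
  `freqLp (cos²θ · G) = mulSqFst ∘ freqLp G` (`freqLp_cosSqMul_ae_eq`) — the term `a² cos²θ ∂_t²`
  of `ρ²□_g` thus becomes `-a²ω² cos²θ`, the `ν² cos²θ` of the spheroidal operator `P(aω)`.

## References

* M. Dafermos, I. Rodnianski, Y. Shlapentokh-Rothman, arXiv:1402.7034, Def. 5.1.1, §5.2.2.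
  [DafermosRodnianskiShlapentokhrothman2014]
-/

noncomputable section

open Real Set Filter MeasureTheory Function
open scoped Topology ENNReal FourierTransform

namespace Literature.Geometry.Lorentzian

namespace Kerr

open Literature.Analysis.SpecialFunctions Literature.Analysis.FunctionSpaces
  Literature.Analysis.Fourier

variable [h2π : Fact (0 < 2 * π)]

/-- The sphere space `𝓚 = L²([-1, 1] × 𝕋)`. [folklore] -/
abbrev AngSpace : Type := Lp ℂ 2 (sphereMeasure (2 * π))

/-! ### Time square-integrability and the time-`L²` class -/

/-- Joint continuity of `(r, t) ↦ angSlice G t r`. [folklore] -/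
theorem continuous_angSlice_swap (G : E4 → ℝ) (hG : Continuous G) :
    Continuous (uncurry fun r t ↦ angSlice G hG t r) :=
  (continuous_angSlice G hG).comp (continuous_snd.prodMk continuous_fst)

/-- **Time square-integrability of the slices at radius `r`**: `∫ ‖G(t, r, ·)‖²_{L²(S²)} dt < ∞`
(one entry of DRSR's "sufficiently integrable", Def. 5.1.1).
[cite: DafermosRodnianskiShlapentokhrothman2014, Def. 5.1.1] -/
def TimeSqInt (G : E4 → ℝ) (hG : Continuous G) (r : ℝ) : Prop :=
  MemLp (fun t ↦ angSlice G hG t r) 2 (volume : Measure ℝ)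

/-- `TimeSqInt` is finiteness of `∫ ‖angSlice G t r‖² dt`. [folklore] -/
theorem timeSqInt_iff (G : E4 → ℝ) (hG : Continuous G) (r : ℝ) :
    TimeSqInt G hG r ↔ ∫⁻ t, ‖angSlice G hG t r‖ₑ ^ 2 < ∞ := by
  have hm : AEStronglyMeasurable (fun t ↦ angSlice G hG t r) (volume : Measure ℝ) :=
    ((continuous_angSlice G hG).comp (continuous_id.prodMk continuous_const)).aestronglyMeasurable
  constructor
  · intro h
    rw [lintegral_enorm_sq_eq_eLpNorm_sq]
    exact ENNReal.pow_lt_top h.2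
  · intro h
    refine ⟨hm, ?_⟩
    rw [lintegral_enorm_sq_eq_eLpNorm_sq] at h
    refine lt_top_iff_ne_top.2 fun htop ↦ ?_
    rw [htop, ENNReal.top_pow two_ne_zero] at h
    exact lt_irrefl _ h

/-- **The time-`L²` class `[t ↦ G(t, r, ·)] ∈ 𝓗 = L²(ℝ; 𝓚)`** at radius `r`. [folklore] -/
def timeLp (G : E4 → ℝ) (hG : Continuous G) (hI : ∀ r, TimeSqInt G hG r) (r : ℝ) :
    Lp AngSpace 2 (volume : Measure ℝ) :=
  (hI r).toLp _

/-- The class is represented by the slices. [folklore] -/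
theorem coeFn_timeLp (G : E4 → ℝ) (hG : Continuous G) (hI : ∀ r, TimeSqInt G hG r) (r : ℝ) :
    (timeLp G hG hI r : ℝ → AngSpace) =ᵐ[volume] fun t ↦ angSlice G hG t r :=
  (hI r).coeFn_toLp

/-! ### Regularity in `r` -/

/-- **Continuity in `r`** of `timeLp G` under a uniform time-`L²` bound on the slices of `∂₁G`.
[folklore] -/
theorem continuous_timeLp {G : E4 → ℝ} (hG : ContDiff ℝ 1 G)
    (hI : ∀ r, TimeSqInt G hG.continuous r)
    {c : ℝ} (hc : 0 ≤ c)
    (hB : ∀ r, ∫⁻ t, ‖angSlice (dir 1 G) (continuous_dir hG one_ne_zero 1) t r‖ₑ ^ 2 ≤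
      ENNReal.ofReal (c ^ 2)) :
    Continuous (timeLp G hG.continuous hI) :=
  continuous_toLp (fun t r ↦ hasDerivAt_angSlice_r hG t r)
    (continuous_angSlice_swap _ (continuous_dir hG one_ne_zero 1)).stronglyMeasurable hc hB hI

omit h2π in
/-- `ContDiff ℝ 2 G` gives `ContDiff ℝ 1 (∂_i G)`. [folklore] -/
theorem contDiff_one_dir {G : E4 → ℝ} (hG : ContDiff ℝ 2 G) (i : Fin 4) : ContDiff ℝ 1 (dir i G) :=
  contDiff_dir (n := 1) (by norm_num; exact hG) i

/-- **Differentiability in `r`**: for `G ∈ C²` with time square-integrable slices of `G`, `∂₁G`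
and a uniform bound for `∂₁∂₁G`, `r ↦ timeLp G r` has derivative `timeLp (∂₁G) r` in `𝓗`.
[folklore] -/
theorem hasDerivAt_timeLp {G : E4 → ℝ} (hG : ContDiff ℝ 2 G)
    (hI₀ : ∀ r, TimeSqInt G hG.continuous r)
    (hI₁ : ∀ r, TimeSqInt (dir 1 G) (contDiff_one_dir hG 1).continuous r) {c : ℝ} (hc : 0 ≤ c)
    (hB : ∀ r, ∫⁻ t, ‖angSlice (dir 1 (dir 1 G))
      (continuous_dir (contDiff_one_dir hG 1) one_ne_zero 1) t r‖ₑ ^ 2 ≤ ENNReal.ofReal (c ^ 2))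
    (r : ℝ) :
    HasDerivAt (timeLp G hG.continuous hI₀)
      (timeLp (dir 1 G) (contDiff_one_dir hG 1).continuous hI₁ r) r :=
  hasDerivAt_toLp r (fun t r ↦ hasDerivAt_angSlice_r (hG.of_le one_le_two) t r)
    (continuous_angSlice_swap _ (contDiff_one_dir hG 1).continuous).stronglyMeasurable hI₀ hI₁
    (continuous_timeLp (contDiff_one_dir hG 1) hI₁ hc hB).continuousAt

/-! ### The Fourier transform in `t*` -/

/-- **`freqLp G r = 𝓕 (timeLp G r) ∈ L²(ℝ_ξ; 𝓚)`** (Mathlib's `L²` transform; DRSR's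
`ω = -2πξ`). [cite: DafermosRodnianskiShlapentokhrothman2014, §5.2.2] -/
def freqLp (G : E4 → ℝ) (hG : Continuous G) (hI : ∀ r, TimeSqInt G hG r) (r : ℝ) :
    Lp AngSpace 2 (volume : Measure ℝ) :=
  𝓕 (timeLp G hG hI r)

/-- Unfolding. [folklore] -/
theorem freqLp_def (G : E4 → ℝ) (hG : Continuous G) (hI : ∀ r, TimeSqInt G hG r) (r : ℝ) :
    freqLp G hG hI r = 𝓕 (timeLp G hG hI r) := rfl

/-- `𝓕` on `𝓗` is the continuous linear map `Lp.fourierTransformₗᵢ`. [folklore] -/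
theorem freqLp_eq_clm (G : E4 → ℝ) (hG : Continuous G) (hI : ∀ r, TimeSqInt G hG r) :
    freqLp G hG hI = fun r ↦ ((Lp.fourierTransformₗᵢ ℝ AngSpace).toContinuousLinearEquiv :
      Lp AngSpace 2 (volume : Measure ℝ) →L[ℂ] Lp AngSpace 2 (volume : Measure ℝ))
        (timeLp G hG hI r) := rfl

/-- Continuity of `freqLp` in `r`. [folklore] -/
theorem continuous_freqLp {G : E4 → ℝ} (hG : ContDiff ℝ 1 G)
    (hI : ∀ r, TimeSqInt G hG.continuous r)
    {c : ℝ} (hc : 0 ≤ c)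
    (hB : ∀ r, ∫⁻ t, ‖angSlice (dir 1 G) (continuous_dir hG one_ne_zero 1) t r‖ₑ ^ 2 ≤
      ENNReal.ofReal (c ^ 2)) :
    Continuous (freqLp G hG.continuous hI) := by
  rw [freqLp_eq_clm]
  exact (ContinuousLinearMap.continuous _).comp (continuous_timeLp hG hI hc hB)

/-- **Differentiability of `freqLp` in `r`** with derivative `freqLp (∂₁G)`. [folklore] -/
theorem hasDerivAt_freqLp {G : E4 → ℝ} (hG : ContDiff ℝ 2 G)
    (hI₀ : ∀ r, TimeSqInt G hG.continuous r)
    (hI₁ : ∀ r, TimeSqInt (dir 1 G) (contDiff_one_dir hG 1).continuous r) {c : ℝ} (hc : 0 ≤ c)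
    (hB : ∀ r, ∫⁻ t, ‖angSlice (dir 1 (dir 1 G))
      (continuous_dir (contDiff_one_dir hG 1) one_ne_zero 1) t r‖ₑ ^ 2 ≤ ENNReal.ofReal (c ^ 2))
    (r : ℝ) :
    HasDerivAt (freqLp G hG.continuous hI₀)
      (freqLp (dir 1 G) (contDiff_one_dir hG 1).continuous hI₁ r) r := by
  rw [freqLp_eq_clm, freqLp_eq_clm]
  exact (((Lp.fourierTransformₗᵢ ℝ AngSpace).toContinuousLinearEquiv :
      Lp AngSpace 2 (volume : Measure ℝ) →L[ℂ] Lp AngSpace 2 (volume : Measure ℝ)).restrictScalars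
        ℝ).hasFDerivAt.comp_hasDerivAt r (hasDerivAt_timeLp hG hI₀ hI₁ hc hB r)

/-- **The time-derivative rule `∂_t ↦ 2πiξ = -iω`**: `freqLp (∂₀G) r = (2πiξ) • freqLp G r` for
a.e. `ξ`. [cite: DafermosRodnianskiShlapentokhrothman2014, §5.2.2] -/
theorem freqLp_dir0_ae_eq {G : E4 → ℝ} (hG : ContDiff ℝ 1 G)
    (hI₀ : ∀ r, TimeSqInt G hG.continuous r)
    (hIt : ∀ r, TimeSqInt (dir 0 G) (continuous_dir hG one_ne_zero 0) r) (r : ℝ) :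
    (freqLp (dir 0 G) (continuous_dir hG one_ne_zero 0) hIt r : ℝ → AngSpace) =ᵐ[volume]
      fun ξ ↦ ((2 * π * Complex.I) * ξ : ℂ) • (freqLp G hG.continuous hI₀ r : ℝ → AngSpace) ξ :=
  fourier_deriv_ae_eq (fun t ↦ hasDerivAt_angSlice_t hG t r) (hI₀ r) (hIt r)

/-! ### Multiplication by `cos²θ` -/

/-- **`cos²θ · G`** on coordinate space. [folklore] -/
def cosSqMul (G : E4 → ℝ) (q : E4) : ℝ := cos (q 2) ^ 2 * G q

omit h2π in
/-- `cos²θ · G` is as smooth as `G`. [folklore] -/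
theorem contDiff_cosSqMul {n : WithTop ℕ∞} {G : E4 → ℝ} (hG : ContDiff ℝ n G) :
    ContDiff ℝ n (cosSqMul G) := by
  unfold cosSqMul
  have h2 : ContDiff ℝ n fun q : E4 ↦ q 2 := (PiLp.proj (𝕜 := ℝ) 2 (fun _ : Fin 4 ↦ ℝ) 2).contDiff
  exact ((contDiff_cos.comp h2).pow 2).mul hG

omit h2π in
/-- `cos²θ · G` is continuous if `G` is. [folklore] -/
theorem continuous_cosSqMul {G : E4 → ℝ} (hG : Continuous G) : Continuous (cosSqMul G) := by
  unfold cosSqMul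
  have h2 : Continuous fun q : E4 ↦ q 2 := PiLp.continuous_apply 2 _ 2
  fun_prop

/-- **`angSlice (cos²θ · G) = mulSqFst (angSlice G)`**: multiplication by `cos²θ` is
multiplication by `x²` on `[-1, 1]`. [folklore] -/
theorem angSlice_cosSqMul {G : E4 → ℝ} (hG : Continuous G) (t r : ℝ) :
    angSlice (cosSqMul G) (continuous_cosSqMul hG) t r = mulSqFst (2 * π) (angSlice G hG t r) := by
  refine Lp.ext ?_
  rw [angSlice_def, angSlice_def]
  filter_upwards [coeFn_polarLp (2 * π) _ (continuous_coordSlice (continuous_cosSqMul hG) t r),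
    coeFn_mulSqFst (T := 2 * π) (polarLp (2 * π) (coordSlice G t r) (continuous_coordSlice hG t r)),
    (coeFn_polarLp (2 * π) (coordSlice G t r) (continuous_coordSlice hG t r)),
    ae_fst_mem_Icc (T := 2 * π)] with z h1 h2 h3 hz
  rw [h1, h2, h3, polarFn_coordSlice, polarFn_coordSlice, cosSqMul, starq_apply_two,
    cos_arccos hz.1 hz.2]
  push_cast
  ring

/-- Time square-integrability is inherited by `cos²θ · G` (`‖mulSqFst‖ ≤ 1`). [folklore] -/
theorem timeSqInt_cosSqMul {G : E4 → ℝ} (hG : Continuous G) {r : ℝ} (hI : TimeSqInt G hG r) :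
    TimeSqInt (cosSqMul G) (continuous_cosSqMul hG) r := by
  have heq : (fun t ↦ angSlice (cosSqMul G) (continuous_cosSqMul hG) t r) =
      fun t ↦ mulSqFst (2 * π) (angSlice G hG t r) := funext fun t ↦ angSlice_cosSqMul hG t r
  unfold TimeSqInt
  rw [heq]
  exact ContinuousLinearMap.comp_memLp' (mulSqFst (2 * π)) hI

/-- `timeLp (cos²θ · G) = mulSqFst ∘ timeLp G` in `𝓗`. [folklore] -/
theorem timeLp_cosSqMul {G : E4 → ℝ} (hG : Continuous G) (hI : ∀ r, TimeSqInt G hG r)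
    (hI' : ∀ r, TimeSqInt (cosSqMul G) (continuous_cosSqMul hG) r) (r : ℝ) :
    timeLp (cosSqMul G) (continuous_cosSqMul hG) hI' r =
      (mulSqFst (2 * π)).compLp (timeLp G hG hI r) := by
  refine Lp.ext ?_
  filter_upwards [coeFn_timeLp (cosSqMul G) (continuous_cosSqMul hG) hI' r,
    (mulSqFst (2 * π)).coeFn_compLp (timeLp G hG hI r), coeFn_timeLp G hG hI r] with t h1 h2 h3
  rw [h1, h2, h3, angSlice_cosSqMul]

/-- **`freqLp (cos²θ · G) = mulSqFst ∘ freqLp G`** a.e. in `ξ`: fibre multiplication by `cos²θ`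
commutes with the time Fourier transform. [folklore] -/
theorem freqLp_cosSqMul_ae_eq {G : E4 → ℝ} (hG : Continuous G) (hI : ∀ r, TimeSqInt G hG r)
    (hI' : ∀ r, TimeSqInt (cosSqMul G) (continuous_cosSqMul hG) r) (r : ℝ) :
    (freqLp (cosSqMul G) (continuous_cosSqMul hG) hI' r : ℝ → AngSpace) =ᵐ[volume]
      fun ξ ↦ mulSqFst (2 * π) ((freqLp G hG hI r : ℝ → AngSpace) ξ) := by
  rw [freqLp_def, timeLp_cosSqMul hG hI hI', freqLp_def]
  exact fourier_compLp_ae_eq (mulSqFst (2 * π)) (timeLp G hG hI r)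

end Kerr

end Literature.Geometry.Lorentzian
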